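import Summits.BirchSwinnertonDyer.BirchSwinnertonDyer.Theses.ManinLocalTwoThree
import Summits.BirchSwinnertonDyer.Rank1Residual.ManinAdditive.ShimuraLedger
import Literature.NumberTheory.EllipticCurves.ManinConstantGamma1Gamma0LedgerProofs
import HarnessLib

/-!
# The Γ₀/Γ₁ ledger BY NAME: C2 ⟺ (Stevens-odd ∧ no doubling), C3 ⟺ (Stevens-prime-to-3 ∧ no tripling);
# E-an-66/67 reduced to the one Néron bit «doubling ⟹ a non-blind rational 2-torsion point»

Summit `BirchSwinnertonDyer`, route `ManinLocalTwoThree` (cell bsd-f2-manin), cruxes C2 `ManinOddAtFour`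
(stmt-BirchSwinnertonDyer-22967) and C3 `ManinPrimeToThreeAtNine` (stmt-BirchSwinnertonDyer-22968).  Edges over the
UNCONDITIONAL ledger of `Literature/…/ManinConstantGamma1Gamma0LedgerProofs.lean` (p629489: ČNS Lemma 6.5 `c₁ ∣ c₀`
DISCHARGED + Ling–Oesterlé converse `c₀ ∣ p c₁` at a traceless prime), for the optimal `X₁(N)`-datum `D₁` (Stevens' curve
`W₁`) and the optimal `X₀(N)`-datum `D₀` (`W₀`) of one isogeny class:

* `not_two_dvd_maninConstant₀_iff_of_four_dvd_level` — at `4 ∣ N`: `2 ∤ c₀ ⟺ (2 ∤ c₁ ∧ |c₀| = |c₁|)`;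
  `not_three_dvd_maninConstant₀_iff_of_nine_dvd_level` — at `9 ∣ N`: `3 ∤ c₀ ⟺ (3 ∤ c₁ ∧ |c₀| = |c₁|)`;
  `dvd_maninConstant₀_iff_of_four_dvd_of_nine_dvd_level` — at `36 ∣ N`: `ℓ ∣ c₀ ⟺ ℓ ∣ c₁` for every `ℓ`.
* `shimuraLedgerAtFour_of_double_imp_nonBlind`, `totallyBlindGammaOneTransfer_of_double_imp_nonBlind`,
  `totallyBlindGammaOneTransfer_of_blind_imp_natAbs_eq` — the an planner's rows E-an-67 / E-an-66 (`ShimuraLedger.lean`)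
  follow from the single residual implication «`|c₀| = 2|c₁|` ⟹ `W₀` has a NON-blind rational `2`-torsion point»
  (resp. «all rational `2`-torsion blind ⟹ `|c₀| = |c₁|`»); their numeric part is the Literature ledger.
* `maninOddAtFour_of_exists_of_stevensOdd_of_noDoubling`, `maninPrimeToThreeAtNine_of_exists_of_stevens_of_noTripling`
  — the cruxes BY NAME from: the printed F-need `exists_optimal_gamma1ParametrizationData` (Conrad–Edixhoven–Stein 2003
  §6.1 / Stevens 1989 §2, statement-only), Stevens-type parity of `c₁` on the relevant classes, and the «no doubling /
  no tripling» bit — written INLINE as hypotheses (no new definitions; the cell types them if wanted).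

HONEST FRAMING: reductions and equivalences only; no Manin constant's parity is decided; C2/C3 remain open; Manin's
conjecture is not proved; BSD is not proved by this.  No definitions.
-/

set_option autoImplicit false
-- the summit-side namespace `Summit.BirchSwinnertonDyer.BirchSwinnertonDyer.…` is the tree's (summit = sub-problem)
set_option linter.dupNamespace false

noncomputable section

open WeierstrassCurve Literature.NumberTheory.EllipticCurves Literature.NumberTheory.EllipticCurves.ModularForms
open Summit.BirchSwinnertonDyer.Rank1Residual.ManinAdditive.ShimuraLedger

namespace Summit.BirchSwinnertonDyer.BirchSwinnertonDyer.Theorems.ManinLocalTwoThree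

variable {W₁ W₀ : WeierstrassCurve ℚ} [W₁.IsElliptic] [W₁.IsGloballyMinimal] [W₀.IsElliptic]
  [W₀.IsGloballyMinimal] {N : ℕ} [NeZero N]

/-- `(p : ℤ) ∣ c ⟺ p ∣ |c|` for a natural number `p`. [folklore] -/
private theorem natCast_dvd_iff_dvd_natAbs (p : ℕ) (c : ℤ) : (p : ℤ) ∣ c ↔ p ∣ c.natAbs := by
  rw [← Int.natAbs_dvd_natAbs, Int.natAbs_natCast]

/-- **The ledger at a traceless prime, divisibility form**: `p ∤ c₀ ⟺ (p ∤ c₁ ∧ |c₀| = |c₁|)` for the optimal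
`X₁(N)`- and `X₀(N)`-data of a class and a prime `p ∣ N` with `a_p(f) = 0` (`c₁ ∣ c₀ ∣ p c₁`). -/
theorem not_dvd_maninConstant₀_iff_of_cuspCoeff_eq_zero (D₁ : Gamma1ParametrizationData W₁ N)
    (D₀ : ModularParametrizationData W₀ N) (hiso : IsIsogenous W₁ W₀) (h₁ : D₁.IsOptimal)
    (h₀ : ∀ z ∈ D₀.L.lattice, ∃ w ∈ periodLattice D₀.f, z = D₀.c * w) {p : ℕ} (hp : p.Prime)
    (hpN : p ∣ N) (hap : cuspCoeff D₀.f p = 0) :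
    ¬ (p : ℤ) ∣ D₀.maninConstant ↔
      ¬ (p : ℤ) ∣ D₁.maninConstant ∧ D₀.maninConstant.natAbs = D₁.maninConstant.natAbs := by
  have hdvd : D₁.maninConstant ∣ D₀.maninConstant := h₁.maninConstant_dvd_maninConstant D₀ hiso
  rw [natCast_dvd_iff_dvd_natAbs, natCast_dvd_iff_dvd_natAbs]
  rcases natAbs_maninConstant₀_eq_or_eq_mul_of_cuspCoeff_eq_zero D₁ D₀ hiso h₁ h₀ hp hpN hap with h | h
  · rw [h]
    exact ⟨fun h' ↦ ⟨h', rfl⟩, fun h' ↦ h'.1⟩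
  · rw [h]
    constructor
    · intro h'
      exact absurd (dvd_mul_right p _) h'
    · rintro ⟨h', heq⟩
      have hc₁ : D₁.maninConstant.natAbs ≠ 0 := Int.natAbs_ne_zero.mpr D₁.maninConstant_ne_zero
      have hp1 : p = 1 := by
        have : p * D₁.maninConstant.natAbs = 1 * D₁.maninConstant.natAbs := by rw [one_mul]; exact heq
        exact Nat.eq_of_mul_eq_mul_right (Nat.pos_of_ne_zero hc₁) this
      exact absurd hp1 hp.one_lt.ne'

/-- **C2-ledger at `4 ∣ N`: `2 ∤ c₀ ⟺ (2 ∤ c₁ ∧ |c₀| = |c₁|)`** for the optimal `X₁(N)`-datum `D₁` and the optimal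
`X₀(N)`-datum `D₀` of one class (globally minimal models).  So C2 for `D₀` splits into Stevens' parity at `2` for the
class AND the «no doubling» bit of the Shimura cover; conversely C2 gives both. -/
theorem not_two_dvd_maninConstant₀_iff_of_four_dvd_level (D₁ : Gamma1ParametrizationData W₁ N)
    (D₀ : ModularParametrizationData W₀ N) (hiso : IsIsogenous W₁ W₀) (h₁ : D₁.IsOptimal)
    (h₀ : ∀ z ∈ D₀.L.lattice, ∃ w ∈ periodLattice D₀.f, z = D₀.c * w) (h4 : 2 ^ 2 ∣ N) :
    ¬ (2 : ℤ) ∣ D₀.maninConstant ↔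
      ¬ (2 : ℤ) ∣ D₁.maninConstant ∧ D₀.maninConstant.natAbs = D₁.maninConstant.natAbs := by
  exact_mod_cast not_dvd_maninConstant₀_iff_of_cuspCoeff_eq_zero D₁ D₀ hiso h₁ h₀ Nat.prime_two
    ((dvd_pow_self 2 two_ne_zero).trans h4) (D₀.isNewformOf.1.cuspCoeff_eq_zero_of_sq_dvd Nat.prime_two h4)

/-- **C3-ledger at `9 ∣ N`: `3 ∤ c₀ ⟺ (3 ∤ c₁ ∧ |c₀| = |c₁|)`.** -/
theorem not_three_dvd_maninConstant₀_iff_of_nine_dvd_level (D₁ : Gamma1ParametrizationData W₁ N)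
    (D₀ : ModularParametrizationData W₀ N) (hiso : IsIsogenous W₁ W₀) (h₁ : D₁.IsOptimal)
    (h₀ : ∀ z ∈ D₀.L.lattice, ∃ w ∈ periodLattice D₀.f, z = D₀.c * w) (h9 : 3 ^ 2 ∣ N) :
    ¬ (3 : ℤ) ∣ D₀.maninConstant ↔
      ¬ (3 : ℤ) ∣ D₁.maninConstant ∧ D₀.maninConstant.natAbs = D₁.maninConstant.natAbs := by
  exact_mod_cast not_dvd_maninConstant₀_iff_of_cuspCoeff_eq_zero D₁ D₀ hiso h₁ h₀ Nat.prime_three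
    ((dvd_pow_self 3 two_ne_zero).trans h9) (D₀.isNewformOf.1.cuspCoeff_eq_zero_of_sq_dvd Nat.prime_three h9)

/-- **At `36 ∣ N` the two optimal constants have the same divisors**: `ℓ ∣ c₀ ⟺ ℓ ∣ c₁` for every integer `ℓ`
(`|c₀| = |c₁|`, two traceless primes). In particular C2 and C3 for `D₀` are exactly Stevens' statements for `D₁`. -/
theorem dvd_maninConstant₀_iff_of_four_dvd_of_nine_dvd_level (D₁ : Gamma1ParametrizationData W₁ N)
    (D₀ : ModularParametrizationData W₀ N) (hiso : IsIsogenous W₁ W₀) (h₁ : D₁.IsOptimal)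
    (h₀ : ∀ z ∈ D₀.L.lattice, ∃ w ∈ periodLattice D₀.f, z = D₀.c * w) (h4 : 2 ^ 2 ∣ N) (h9 : 3 ^ 2 ∣ N)
    (ℓ : ℤ) : ℓ ∣ D₀.maninConstant ↔ ℓ ∣ D₁.maninConstant := by
  have heq := natAbs_maninConstant₀_eq_of_sq_dvd_level_of_ne D₁ D₀ hiso h₁ h₀ Nat.prime_two Nat.prime_three
    (by decide) h4 h9
  rw [← Int.natAbs_dvd_natAbs, ← Int.natAbs_dvd_natAbs (b := D₁.maninConstant), heq]

/-! ### E-an-67 / E-an-66 reduced to the Néron bit -/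

/-- **E-an-67 `ShimuraLedgerAtFour` ⟸ «doubling forces a NON-blind rational 2-torsion point».**  The numeric
trichotomy-free part `|c₀| ∈ {|c₁|, 2|c₁|}` is the Literature ledger; what remains of the an planner's row is the single
implication fed here as `h` (on paper: ČNS 6.5 exact form + «blind ⟺ `ψ_T` not étale», E-an-54). -/
theorem shimuraLedgerAtFour_of_double_imp_nonBlind
    (h : ∀ (W₁ W₀ : WeierstrassCurve ℚ) [W₁.IsElliptic] [W₁.IsGloballyMinimal] [W₀.IsElliptic]
      [W₀.IsGloballyMinimal] {N : ℕ} [NeZero N] (D₁ : Gamma1ParametrizationData W₁ N)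
      (D₀ : ModularParametrizationData W₀ N), IsIsogenous W₁ W₀ → D₁.IsOptimal →
      (∀ z ∈ D₀.L.lattice, ∃ w ∈ periodLattice D₀.f, z = D₀.c * w) → 2 ^ 2 ∣ N → W₀.a₁ = 0 → W₀.a₃ = 0 →
      D₀.maninConstant.natAbs = 2 * D₁.maninConstant.natAbs → HasNonBlindRationalTwoTorsion W₀) :
    ShimuraLedgerAtFour := by
  intro W₁ W₀ _ _ _ _ N _ D₁ D₀ hiso h₁ h₀ h4 ha₁ ha₃
  rcases natAbs_maninConstant₀_eq_or_eq_two_mul_of_four_dvd_level D₁ D₀ hiso h₁ h₀ h4 with h' | h'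
  · exact Or.inl h'
  · exact Or.inr ⟨h', h W₁ W₀ D₁ D₀ hiso h₁ h₀ h4 ha₁ ha₃ h'⟩

/-- **E-an-66 `TotallyBlindGammaOneTransfer` ⟸ the same Néron bit** (through the leaf's edge
`totallyBlindGammaOneTransfer_of_ledger`). -/
theorem totallyBlindGammaOneTransfer_of_double_imp_nonBlind
    (h : ∀ (W₁ W₀ : WeierstrassCurve ℚ) [W₁.IsElliptic] [W₁.IsGloballyMinimal] [W₀.IsElliptic]
      [W₀.IsGloballyMinimal] {N : ℕ} [NeZero N] (D₁ : Gamma1ParametrizationData W₁ N)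
      (D₀ : ModularParametrizationData W₀ N), IsIsogenous W₁ W₀ → D₁.IsOptimal →
      (∀ z ∈ D₀.L.lattice, ∃ w ∈ periodLattice D₀.f, z = D₀.c * w) → 2 ^ 2 ∣ N → W₀.a₁ = 0 → W₀.a₃ = 0 →
      D₀.maninConstant.natAbs = 2 * D₁.maninConstant.natAbs → HasNonBlindRationalTwoTorsion W₀) :
    TotallyBlindGammaOneTransfer :=
  totallyBlindGammaOneTransfer_of_ledger (shimuraLedgerAtFour_of_double_imp_nonBlind h)

/-- **E-an-66 ⟸ «all rational 2-torsion blind ⟹ no doubling»** (the blind-side form of the Néron bit: a totally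
blind `X₀`-optimal curve at `4 ∣ N` has `|c₀| ≠ 2|c₁|`; then `|c₀| = |c₁|` by the ledger). -/
theorem totallyBlindGammaOneTransfer_of_blind_imp_ne_double
    (h : ∀ (W₁ W₀ : WeierstrassCurve ℚ) [W₁.IsElliptic] [W₁.IsGloballyMinimal] [W₀.IsElliptic]
      [W₀.IsGloballyMinimal] {N : ℕ} [NeZero N] (D₁ : Gamma1ParametrizationData W₁ N)
      (D₀ : ModularParametrizationData W₀ N), IsIsogenous W₁ W₀ → D₁.IsOptimal →
      (∀ z ∈ D₀.L.lattice, ∃ w ∈ periodLattice D₀.f, z = D₀.c * w) → 2 ^ 2 ∣ N → W₀.a₁ = 0 → W₀.a₃ = 0 →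
      AllRationalTwoTorsionBlind W₀ → D₀.maninConstant.natAbs ≠ 2 * D₁.maninConstant.natAbs) :
    TotallyBlindGammaOneTransfer := by
  intro W₁ W₀ _ _ _ _ N _ D₁ D₀ hiso h₁ h₀ h4 ha₁ ha₃ hblind
  rcases natAbs_maninConstant₀_eq_or_eq_two_mul_of_four_dvd_level D₁ D₀ hiso h₁ h₀ h4 with h' | h'
  · exact h'
  · exact absurd h' (h W₁ W₀ D₁ D₀ hiso h₁ h₀ h4 ha₁ ha₃ hblind)

/-! ### With the printed F-need: every lattice-optimal `D₀` has a Stevens partner `D₁` -/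

/-- **With Stevens' `X₁(N)`-optimal curve supplied by the printed existence fact** (`exists_optimal_gamma1ParametrizationData`,
Conrad–Edixhoven–Stein 2003 §6.1, statement-only): for every lattice-optimal `X₀(N)`-datum `D₀` with `4 ∣ N` there is an
optimal `X₁(N)`-datum `D₁` of an isogenous globally minimal curve with `c₁ ∣ c₀` and `|c₀| ∈ {|c₁|, 2|c₁|}`. -/
theorem exists_stevens_partner_of_four_dvd_level (hex : exists_optimal_gamma1ParametrizationData)
    (D₀ : ModularParametrizationData W₀ N) (h₀ : ∀ z ∈ D₀.L.lattice, ∃ w ∈ periodLattice D₀.f, z = D₀.c * w)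
    (h4 : 2 ^ 2 ∣ N) :
    ∃ (W₁ : WeierstrassCurve ℚ) (_ : W₁.IsElliptic) (_ : W₁.IsGloballyMinimal)
      (D₁ : Gamma1ParametrizationData W₁ N), IsIsogenous W₁ W₀ ∧ D₁.IsOptimal ∧
        D₁.maninConstant ∣ D₀.maninConstant ∧
        (D₀.maninConstant.natAbs = D₁.maninConstant.natAbs ∨
          D₀.maninConstant.natAbs = 2 * D₁.maninConstant.natAbs) := by
  obtain ⟨W₁, i₁, i₂, D₁, hiso, h₁⟩ := hex W₀ D₀ h₀
  exact ⟨W₁, i₁, i₂, D₁, hiso, h₁, h₁.maninConstant_dvd_maninConstant D₀ hiso,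
    natAbs_maninConstant₀_eq_or_eq_two_mul_of_four_dvd_level D₁ D₀ hiso h₁ h₀ h4⟩

/-- **C2 BY NAME ⟸ (F-need) ∧ (Stevens-odd at `4 ∣ N`) ∧ (no doubling at `4 ∣ N`)** — the Γ₀/Γ₁ split of the crux: for
every class with `4 ∣ N`, if the `X₁(N)`-optimal constant `c₁` is odd (`hS`; CES Conj. 6.1.7 predicts `c₁ = 1`) and the
Shimura cover does not double the constant (`hND`: `|c₀| = |c₁|`), then `2 ∤ c₀`.  The crux's four printed-fact binders
are not used. -/
theorem maninOddAtFour_of_exists_of_stevensOdd_of_noDoubling (hex : exists_optimal_gamma1ParametrizationData)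
    (hS : ∀ (W₁ W₀ : WeierstrassCurve ℚ) [W₁.IsElliptic] [W₁.IsGloballyMinimal] [W₀.IsElliptic]
      [W₀.IsGloballyMinimal] {N : ℕ} [NeZero N] (D₁ : Gamma1ParametrizationData W₁ N)
      (D₀ : ModularParametrizationData W₀ N), IsIsogenous W₁ W₀ → D₁.IsOptimal →
      (∀ z ∈ D₀.L.lattice, ∃ w ∈ periodLattice D₀.f, z = D₀.c * w) → 2 ^ 2 ∣ N →
      ¬ (2 : ℤ) ∣ D₁.maninConstant)
    (hND : ∀ (W₁ W₀ : WeierstrassCurve ℚ) [W₁.IsElliptic] [W₁.IsGloballyMinimal] [W₀.IsElliptic]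
      [W₀.IsGloballyMinimal] {N : ℕ} [NeZero N] (D₁ : Gamma1ParametrizationData W₁ N)
      (D₀ : ModularParametrizationData W₀ N), IsIsogenous W₁ W₀ → D₁.IsOptimal →
      (∀ z ∈ D₀.L.lattice, ∃ w ∈ periodLattice D₀.f, z = D₀.c * w) → 2 ^ 2 ∣ N →
      D₀.maninConstant.natAbs = D₁.maninConstant.natAbs) :
    Summit.BirchSwinnertonDyer.BirchSwinnertonDyer.Theses.ManinLocalTwoThree.ManinOddAtFour := by
  intro _hM _hAU _hC _hnf W₀ _ _ N _ D₀ h₀ h4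
  obtain ⟨W₁, i₁, i₂, D₁, hiso, h₁⟩ := hex W₀ D₀ h₀
  exact (not_two_dvd_maninConstant₀_iff_of_four_dvd_level D₁ D₀ hiso h₁ h₀ h4).mpr
    ⟨hS W₁ W₀ D₁ D₀ hiso h₁ h₀ h4, hND W₁ W₀ D₁ D₀ hiso h₁ h₀ h4⟩

/-- **C3 BY NAME ⟸ (F-need) ∧ (Stevens prime-to-`3` at `9 ∣ N`) ∧ (no tripling at `9 ∣ N`).** -/
theorem maninPrimeToThreeAtNine_of_exists_of_stevens_of_noTripling (hex : exists_optimal_gamma1ParametrizationData)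
    (hS : ∀ (W₁ W₀ : WeierstrassCurve ℚ) [W₁.IsElliptic] [W₁.IsGloballyMinimal] [W₀.IsElliptic]
      [W₀.IsGloballyMinimal] {N : ℕ} [NeZero N] (D₁ : Gamma1ParametrizationData W₁ N)
      (D₀ : ModularParametrizationData W₀ N), IsIsogenous W₁ W₀ → D₁.IsOptimal →
      (∀ z ∈ D₀.L.lattice, ∃ w ∈ periodLattice D₀.f, z = D₀.c * w) → 3 ^ 2 ∣ N →
      ¬ (3 : ℤ) ∣ D₁.maninConstant)
    (hNT : ∀ (W₁ W₀ : WeierstrassCurve ℚ) [W₁.IsElliptic] [W₁.IsGloballyMinimal] [W₀.IsElliptic]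
      [W₀.IsGloballyMinimal] {N : ℕ} [NeZero N] (D₁ : Gamma1ParametrizationData W₁ N)
      (D₀ : ModularParametrizationData W₀ N), IsIsogenous W₁ W₀ → D₁.IsOptimal →
      (∀ z ∈ D₀.L.lattice, ∃ w ∈ periodLattice D₀.f, z = D₀.c * w) → 3 ^ 2 ∣ N →
      D₀.maninConstant.natAbs = D₁.maninConstant.natAbs) :
    Summit.BirchSwinnertonDyer.BirchSwinnertonDyer.Theses.ManinLocalTwoThree.ManinPrimeToThreeAtNine := by
  intro _hM _hAU _hC _hnf W₀ _ _ N _ D₀ h₀ h9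
  obtain ⟨W₁, i₁, i₂, D₁, hiso, h₁⟩ := hex W₀ D₀ h₀
  exact (not_three_dvd_maninConstant₀_iff_of_nine_dvd_level D₁ D₀ hiso h₁ h₀ h9).mpr
    ⟨hS W₁ W₀ D₁ D₀ hiso h₁ h₀ h9, hNT W₁ W₀ D₁ D₀ hiso h₁ h₀ h9⟩

/-- **Conversely C2 forces both bits**: for the optimal pair of a class with `4 ∣ N`, `2 ∤ c₀` gives `2 ∤ c₁` and
`|c₀| = |c₁|` (so C2 ⟹ Stevens' parity at `2` for every class with `4 ∣ N`, and C2 ⟹ no doubling). -/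
theorem stevensOdd_and_noDoubling_of_not_two_dvd_maninConstant₀ (D₁ : Gamma1ParametrizationData W₁ N)
    (D₀ : ModularParametrizationData W₀ N) (hiso : IsIsogenous W₁ W₀) (h₁ : D₁.IsOptimal)
    (h₀ : ∀ z ∈ D₀.L.lattice, ∃ w ∈ periodLattice D₀.f, z = D₀.c * w) (h4 : 2 ^ 2 ∣ N)
    (hodd : ¬ (2 : ℤ) ∣ D₀.maninConstant) :
    ¬ (2 : ℤ) ∣ D₁.maninConstant ∧ D₀.maninConstant.natAbs = D₁.maninConstant.natAbs :=
  (not_two_dvd_maninConstant₀_iff_of_four_dvd_level D₁ D₀ hiso h₁ h₀ h4).mp hodd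

end Summit.BirchSwinnertonDyer.BirchSwinnertonDyer.Theorems.ManinLocalTwoThree

end
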